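import Literature.AlgebraicGeometry.Motives.MixedHodgeStructureIndecomposable
import Literature.AlgebraicGeometry.Motives.MixedHodgeStructureLoewyLength
import HarnessLib

/-!
# Simplicity and indecomposability of a mixed Hodge structure under duality and direct sums

Fujiki, *Duality of mixed Hodge structures* (1.6.2): `S ↦ S^⊥` is an inclusion-reversing bijection between the
sub-MHS of `H` and of `H^∨` (the tree's `annihilator` / `coannihilator`, `MixedHodgeStructureSocleRadicalDuality`),
exchanging `⊕`-decompositions. Hence **`H` is simple iff `H^∨` is, indecomposable iff `H^∨` is**, while a direct sum
of two non-zero MHS is never indecomposable (semisimple objects of the abelian category of MHS: Cattani–El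
Zein–Griffiths–Lê, *Hodge Theory*, Thm. 3.2.18, p. 270); the socle and radical SERIES of a direct sum are the direct
sums of the series (functoriality along the four structure morphisms), so **`ℓ(H₁ ⊕ H₂) = max (ℓ H₁) (ℓ H₂)`** for the
Loewy length. Namespace `MixedHodgeStructure`; everything proved, no named facts.

## References

* [Fujiki1980] A. Fujiki, Duality of mixed Hodge structures of algebraic varieties (1980), (1.6.2).
* [CattaniElZeinGriffithsLe2014] E. Cattani et al. (eds.), Hodge Theory (2014), Thm. 3.2.18, p. 270.
-/

noncomputable section

namespace Literature.AlgebraicGeometry.Motives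

namespace MixedHodgeStructure

universe u v

variable {V : Type u} [AddCommGroup V] [Module ℚ V] [FiniteDimensional ℚ V]
variable {H : MixedHodgeStructure V}

open Module

/-! ### §1 Orthogonals of complementary sub-MHS are complementary -/

namespace SubMixedHodgeStructure

/-- `S ⊕ T = H ⇒ S^⊥ ⊕ T^⊥ = H^∨`. [cite: Fujiki1980, (1.6.2) b)] -/
theorem isCompl_annihilator (S T : SubMixedHodgeStructure H) (h : IsCompl S.toSubmodule T.toSubmodule) :
    IsCompl S.annihilator.toSubmodule T.annihilator.toSubmodule := by
  have hsup : S.sup T = top H := ext (by rw [sup_toSubmodule, h.sup_eq_top, top_toSubmodule])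
  have hinf : S.inf T = bot H := ext (by rw [inf_toSubmodule, h.inf_eq_bot, bot_toSubmodule])
  refine IsCompl.of_eq ?_ ?_
  · rw [← inf_toSubmodule, ← annihilator_sup, hsup, annihilator_top, bot_toSubmodule]
  · rw [← sup_toSubmodule, ← annihilator_inf, hinf, annihilator_bot, top_toSubmodule]

/-- `X^⊥ = H^∨ ⇒ X = 0` and `X^⊥ = 0 ⇒ X = H`. [cite: Fujiki1980, (1.6.2) b)] -/
theorem eq_bot_of_annihilator_eq_top (S : SubMixedHodgeStructure H) (h : S.annihilator = top H.dual) : S = bot H := by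
  rw [← coannihilator_annihilator S, h, coannihilator_top]

/-- `X^⊥ = 0 ⇒ X = H`. [cite: Fujiki1980, (1.6.2) b)] -/
theorem eq_top_of_annihilator_eq_bot (S : SubMixedHodgeStructure H) (h : S.annihilator = bot H.dual) : S = top H := by
  rw [← coannihilator_annihilator S, h, coannihilator_bot]

/-- `S' ⊕ T' = H^∨ ⇒ S'_⊥ ⊕ T'_⊥ = H`. [cite: Fujiki1980, (1.6.2) b)] -/
theorem isCompl_coannihilator (S' T' : SubMixedHodgeStructure H.dual)
    (h : IsCompl S'.toSubmodule T'.toSubmodule) :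
    IsCompl S'.coannihilator.toSubmodule T'.coannihilator.toSubmodule := by
  -- apply `⊥` to the identities for `S'_⊥`, `T'_⊥` and use `(X_⊥)^⊥ = X`
  refine IsCompl.of_eq ?_ ?_
  · have h1 : (S'.coannihilator.inf T'.coannihilator).annihilator = top H.dual := by
      rw [annihilator_inf, annihilator_coannihilator, annihilator_coannihilator]
      exact ext (by rw [sup_toSubmodule, h.sup_eq_top, top_toSubmodule])
    rw [← inf_toSubmodule, eq_bot_of_annihilator_eq_top _ h1, bot_toSubmodule]
  · have h2 : (S'.coannihilator.sup T'.coannihilator).annihilator = bot H.dual := by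
      rw [annihilator_sup, annihilator_coannihilator, annihilator_coannihilator]
      exact ext (by rw [inf_toSubmodule, h.inf_eq_bot, bot_toSubmodule])
    rw [← sup_toSubmodule, eq_top_of_annihilator_eq_bot _ h2, top_toSubmodule]

end SubMixedHodgeStructure

/-! ### §2 Simple and indecomposable under duality -/

open SubMixedHodgeStructure in
/-- **`H` simple ⇒ `H^∨` simple** (a sub-MHS `S' ⊆ H^∨` has `S'_⊥ ∈ {0, H}`). [cite: Fujiki1980, (1.6.2) b)]
[cite: CattaniElZeinGriffithsLe2014, p. 270] -/
theorem IsSimple.dual (h : H.IsSimple) : H.dual.IsSimple := by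
  haveI := h.nontrivial
  refine ⟨inferInstance, fun S' => ?_⟩
  rcases h.eq_bot_or_eq_top S'.coannihilator with h' | h'
  · right
    have e : S'.coannihilator = bot H := ext (by rw [h', bot_toSubmodule])
    rw [← annihilator_coannihilator S', e, annihilator_bot, top_toSubmodule]
  · left
    have e : S'.coannihilator = top H := ext (by rw [h', top_toSubmodule])
    rw [← annihilator_coannihilator S', e, annihilator_top, bot_toSubmodule]

/-- **`H^∨` simple iff `H` simple.** [cite: Fujiki1980, (1.6.2)] [cite: CattaniElZeinGriffithsLe2014, p. 270] -/
theorem isSimple_dual_iff : H.dual.IsSimple ↔ H.IsSimple :=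
  ⟨fun h => (isSimple_iff_of_bijective (Hom.bidual H) (Hom.bidual_bijective H)).2 h.dual, IsSimple.dual⟩

open SubMixedHodgeStructure in
/-- **`H` indecomposable ⇒ `H^∨` indecomposable** (a decomposition of `H^∨` gives one of `H` by `⊥`).
[cite: Fujiki1980, (1.6.2) b)] [cite: CattaniElZeinGriffithsLe2014, p. 270] -/
theorem IsIndecomposable.dual (h : H.IsIndecomposable) : H.dual.IsIndecomposable := by
  haveI := h.nontrivial
  refine ⟨inferInstance, fun S' T' hST => ?_⟩
  rcases h.eq_bot_or_eq_bot S'.coannihilator T'.coannihilator (isCompl_coannihilator S' T' hST) with h' | h'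
  · -- `S'_⊥ = 0 ⇒ S' = H^∨ ⇒ T' = 0`
    right
    have e : S'.coannihilator = bot H := ext (by rw [h', bot_toSubmodule])
    have hS' : S'.toSubmodule = ⊤ := by rw [← annihilator_coannihilator S', e, annihilator_bot, top_toSubmodule]
    rw [hS'] at hST
    exact eq_bot_of_top_isCompl hST
  · left
    have e : T'.coannihilator = bot H := ext (by rw [h', bot_toSubmodule])
    have hT' : T'.toSubmodule = ⊤ := by rw [← annihilator_coannihilator T', e, annihilator_bot, top_toSubmodule]
    rw [hT'] at hST
    exact eq_bot_of_isCompl_top hST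

/-- **`H^∨` indecomposable iff `H` indecomposable.** [cite: Fujiki1980, (1.6.2)] [cite: CattaniElZeinGriffithsLe2014, p. 270] -/
theorem isIndecomposable_dual_iff : H.dual.IsIndecomposable ↔ H.IsIndecomposable :=
  ⟨fun h => (isIndecomposable_iff_of_bijective (Hom.bidual H) (Hom.bidual_bijective H)).2 h.dual, IsIndecomposable.dual⟩

/-! ### §3 Direct sums -/

section Prod

variable {V₂ : Type v} [AddCommGroup V₂] [Module ℚ V₂]

omit [FiniteDimensional ℚ V] in
/-- The two axes `H₁ ⊕ 0`, `0 ⊕ H₂` are complementary sub-MHS of `H₁ ⊕ H₂`. [cite: CattaniElZeinGriffithsLe2014, Thm. 3.2.18] -/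
theorem isCompl_range_inl_range_inr (H₁ : MixedHodgeStructure V) (H₂ : MixedHodgeStructure V₂) :
    IsCompl (Hom.inl H₁ H₂).range.toSubmodule (Hom.inr H₁ H₂).range.toSubmodule := by
  rw [Hom.range_toSubmodule, Hom.range_toSubmodule]
  exact LinearMap.isCompl_range_inl_inr

omit [FiniteDimensional ℚ V] in
/-- **A direct sum of two non-zero MHS is not indecomposable.** [cite: CattaniElZeinGriffithsLe2014, p. 270] -/
theorem not_isIndecomposable_prod [Nontrivial V] [Nontrivial V₂] (H₁ : MixedHodgeStructure V)
    (H₂ : MixedHodgeStructure V₂) : ¬(H₁.prod H₂).IsIndecomposable := fun h => by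
  rcases h.eq_bot_or_eq_bot _ _ (isCompl_range_inl_range_inr H₁ H₂) with h' | h' <;>
    rw [Hom.range_toSubmodule, LinearMap.range_eq_bot] at h'
  · obtain ⟨a, ha⟩ := exists_ne (0 : V)
    exact ha (by simpa using LinearMap.congr_fun h' a)
  · obtain ⟨b, hb⟩ := exists_ne (0 : V₂)
    exact hb (by simpa using LinearMap.congr_fun h' b)

omit [FiniteDimensional ℚ V] in
/-- Nor simple. [cite: CattaniElZeinGriffithsLe2014, p. 270] -/
theorem not_isSimple_prod [Nontrivial V] [Nontrivial V₂] (H₁ : MixedHodgeStructure V) (H₂ : MixedHodgeStructure V₂) :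
    ¬(H₁.prod H₂).IsSimple := fun h =>
  not_isIndecomposable_prod H₁ H₂ h.isIndecomposable

omit [FiniteDimensional ℚ V] in
/-- An indecomposable summand decomposition: if `H₁ ⊕ H₂` is indecomposable then `H₁ = 0` or `H₂ = 0`.
[cite: CattaniElZeinGriffithsLe2014, p. 270] -/
theorem IsIndecomposable.subsingleton_or_subsingleton {H₁ : MixedHodgeStructure V} {H₂ : MixedHodgeStructure V₂}
    (h : (H₁.prod H₂).IsIndecomposable) : Subsingleton V ∨ Subsingleton V₂ := by
  by_contra hne
  rw [not_or, not_subsingleton_iff_nontrivial, not_subsingleton_iff_nontrivial] at hne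
  obtain ⟨_, _⟩ := hne
  exact not_isIndecomposable_prod H₁ H₂ h

/-- **`soc^k(H₁ ⊕ H₂) = soc^k H₁ ⊕ soc^k H₂`** (project with `fst`, `snd`; embed with `inl`, `inr`).
[cite: CattaniElZeinGriffithsLe2014, Thm. 3.2.18 and p. 270] -/
theorem socleSeries_prod [FiniteDimensional ℚ V₂] (H₁ : MixedHodgeStructure V) (H₂ : MixedHodgeStructure V₂) (k : ℕ) :
    (socleSeries (H₁.prod H₂) k).toSubmodule = (socleSeries H₁ k).toSubmodule.prod (socleSeries H₂ k).toSubmodule := by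
  refine le_antisymm (fun x hx => ?_) ?_
  · exact ⟨(Hom.fst H₁ H₂).apply_mem_socleSeries hx, (Hom.snd H₁ H₂).apply_mem_socleSeries hx⟩
  · rintro ⟨a, b⟩ ⟨ha, hb⟩
    have e : (Hom.inl H₁ H₂).toLinearMap a + (Hom.inr H₁ H₂).toLinearMap b = (a, b) := by
      rw [Hom.inl_toLinearMap, Hom.inr_toLinearMap, LinearMap.inl_apply, LinearMap.inr_apply, Prod.mk_add_mk,
        add_zero, zero_add]
    rw [← e]
    exact Submodule.add_mem _ ((Hom.inl H₁ H₂).apply_mem_socleSeries ha) ((Hom.inr H₁ H₂).apply_mem_socleSeries hb)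

/-- **`rad^k(H₁ ⊕ H₂) = rad^k H₁ ⊕ rad^k H₂`.** [cite: CattaniElZeinGriffithsLe2014, Thm. 3.2.18 and p. 270] -/
theorem radicalSeries_prod [FiniteDimensional ℚ V₂] (H₁ : MixedHodgeStructure V) (H₂ : MixedHodgeStructure V₂)
    (k : ℕ) : (radicalSeries (H₁.prod H₂) k).toSubmodule =
      (radicalSeries H₁ k).toSubmodule.prod (radicalSeries H₂ k).toSubmodule := by
  refine le_antisymm (fun x hx => ?_) ?_
  · exact ⟨(Hom.fst H₁ H₂).apply_mem_radicalSeries hx, (Hom.snd H₁ H₂).apply_mem_radicalSeries hx⟩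
  · rintro ⟨a, b⟩ ⟨ha, hb⟩
    have e : (Hom.inl H₁ H₂).toLinearMap a + (Hom.inr H₁ H₂).toLinearMap b = (a, b) := by
      rw [Hom.inl_toLinearMap, Hom.inr_toLinearMap, LinearMap.inl_apply, LinearMap.inr_apply, Prod.mk_add_mk,
        add_zero, zero_add]
    rw [← e]
    exact Submodule.add_mem _ ((Hom.inl H₁ H₂).apply_mem_radicalSeries ha)
      ((Hom.inr H₁ H₂).apply_mem_radicalSeries hb)

/-- **`ℓ(H₁ ⊕ H₂) = max (ℓ H₁) (ℓ H₂)`.** [cite: CattaniElZeinGriffithsLe2014, Thm. 3.2.18 and p. 270] -/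
theorem loewyLength_prod [FiniteDimensional ℚ V₂] (H₁ : MixedHodgeStructure V) (H₂ : MixedHodgeStructure V₂) :
    loewyLength (H₁.prod H₂) = max (loewyLength H₁) (loewyLength H₂) := by
  refine le_antisymm ?_ (max_loewyLength_le_loewyLength_prod H₁ H₂)
  rw [loewyLength_le_iff, socleSeries_prod, (loewyLength_le_iff H₁).1 (le_max_left _ _),
    (loewyLength_le_iff H₂).1 (le_max_right _ _)]
  exact Submodule.prod_top

end Prod

/-- One-dimensional MHS are indecomposable. [cite: CattaniElZeinGriffithsLe2014, p. 270] -/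
theorem isIndecomposable_of_finrank_eq_one (hV : finrank ℚ V = 1) (H : MixedHodgeStructure V) : H.IsIndecomposable :=
  (isSimple_of_finrank_eq_one hV H).isIndecomposable

/-- The Tate structures `ℚ(j)` are indecomposable. [cite: CattaniElZeinGriffithsLe2014, p. 270] -/
theorem isIndecomposable_tate (j : ℤ) : (HodgeStructure.tate j).toMixedHodgeStructure.IsIndecomposable :=
  (isSimple_tate j).isIndecomposable

end MixedHodgeStructure

end Literature.AlgebraicGeometry.Motives
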